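import Summits.QuantumFields.YangMills.Theorems.UnitScaleTiltHalvingEffGaugeLevelSeq
import Literature.MathematicalPhysics.QuantumFieldTheory.Balaban1983to89.T3ContinuumYM3Torus
import Literature.MathematicalPhysics.QuantumFieldTheory.Balaban1983to89.B7Prop4Flat
import HarnessLib

/-!
# Line H (`BirthV10.stub_halvingStep`, stmt-QuantumFields-19200) — THE (b)-ROW KNIT, LEVEL DATA: the `if`-lettered stair-size and oscillation sequences `hh ω` of the
# effective-gauge row and their level sequence `E` — ✓`hG_of_rows[_σ]`'s eight numeric rows from four scalar windows ([Balaban1985Averaging] Prop. 4, (139)–(144))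

Cell `ym3-torus` (HUMAN RULING D-0037: YM₃ on T³ is ladder rung R3 — NOT d = 4, NOT infinite volume, NOT a mass gap, NOT the Clay problem), width seat `ym3-torus-px15` gen 4
(LEAD-H ★w5-19200 g7 WORDS 22∕24: the member knit `hStokes_holds` (σ-edition) → px15 g4; ym-ust-20520-w3 g10 05:53:17Z: `hh ω := fun j => if j < K − n then … else 0`).
`--supports stmt-QuantumFields-19200 --as helper`; THEOREMS ONLY (0 `def`, 0 `sorry`); count-neutral; pure real bookkeeping — nothing of (B-al-4), (M2′), the stub or the crux.

WHAT.  ✓`HalvingEffGaugeRowG.hG_of_rows[_σ]` reads two level sequences `hh ω : ℕ → ℝ` with FOUR GLOBAL sign∕size rows (`∀ j`, `hh j ∈ [0, 1∕64]`, `ω j ∈ [0, 1∕600]`) and a level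
sequence `E` with FOUR rows (`0 ≤ E 0`, `E j ≤ 1∕200`, the nonlinear step `hE`, `E k ≤ θG`).  The suppliers deliver `hh j` (w3 g11 ✓`stairSizes_of_guards_inAx`) and `ω j` (px9 g6
✓`omegaRow_of_guards[_σ]`) only for `j < k = K − n`, as CLOSED FORMS; this file fixes the `if`-letters
  `hhL j := if j < k then 4ℓ·(d(L−1)·(4ε₀(Lʲ)²(Lᵏ)⁻²) + (102∕100)·(R·(Lʲ)⁴(Lᵏ)⁻⁴)) else 0`, `R = 240·(C₂ d + 40000(d+2)²)·δc²·ε₀²`,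
  `ωL j := if j < k then <px9's oscillation form at chart bound `cm`> else 0` (`cm` a free nonnegative real: `c′max` pre-σ, `cσ` in the σ-edition),
and proves ★★★ `levelData`: under `64·h⋆ ≤ 1`, `600·w⋆ ≤ 1`, `160·(3b) + 9900·w⋆ + 16128·h⋆ ≤ 1`, `3b ≤ 1∕200` (`h⋆ = 4ℓ(d(L−1)·4ε₀ + (102∕100)R)`, `w⋆ = form(x⋆, a⋆)`,
`x⋆ = d(L−1)·(256(d+1)(d+4)·2ε₀ + cm)`, `a⋆ = 64d·cm`, `b = 23040·h⋆·w⋆ + 4800·w⋆²` — all written out) the eight rows hold with `θG := 3b`, via ym-ust-20520-w3 g10's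
✓`HalvingEffGaugeLevelSeq.exists_levelSeq_rows_L` ∕ `stairSize_closedForm_le_mul_levelRatio` ∕ `omega_closedForm_le_mul_levelRatio` (k-UNIFORM: `hh j, ω j ≤ (h⋆, w⋆)·Lʲ(Lᵏ)⁻¹`).
HONEST SCOPE.  Arithmetic only.

References: T. Bałaban, CMP **98** (1985) 17–51 [Balaban1985Averaging] ((84)–(85) pp.30–31, (99) p.32, Prop. 4 (134)–(135) pp.38–39, (139)–(144) pp.39–40); CMP **99** (1985)
75–102 [Balaban1985RegularSpaces] ((1.29) p.81).
-/

set_option autoImplicit false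

noncomputable section

namespace Summit.QuantumFields.YangMills.Theorems.HalvingHStokesRowLevelData

open Literature.MathematicalPhysics.QuantumFieldTheory.Balaban1983to89
open Literature.MathematicalPhysics.QuantumFieldTheory.Balaban1983to89.T3ContinuumYM3Torus
open B7Prop4Flat (C2 C1_pos)
open HalvingEffGaugeLevelSeq (exists_levelSeq_rows_L stairSize_closedForm_le_mul_levelRatio omega_closedForm_le_mul_levelRatio levelRatio_le_one levelRatio_nonneg
  pow_mul_inv_pow_mul_eq)

variable (F : T3Family) {n K : ℕ}

/-- An `if`-lettered level sequence with a majorant `c·Lʲ(Lᵏ)⁻¹` on `j < k` and `c ≤ C` is GLOBALLY in `[0, C]`. [folklore] -/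
theorem if_level_bounds {k : ℕ} {L c C : ℝ} (hL : 1 ≤ L) (hc : 0 ≤ c) (hcC : c ≤ C) (f : ℕ → ℝ) (hf0 : ∀ j, j < k → 0 ≤ f j)
    (hf : ∀ j, j < k → f j ≤ c * (L ^ j * (L ^ k)⁻¹)) (j : ℕ) :
    0 ≤ (if j < k then f j else 0) ∧ (if j < k then f j else 0) ≤ C := by
  by_cases hj : j < k
  · rw [if_pos hj]
    refine ⟨hf0 j hj, (hf j hj).trans ?_⟩
    exact (mul_le_of_le_one_right hc (levelRatio_le_one hL hj.le)).trans hcC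
  · rw [if_neg hj]; exact ⟨le_rfl, hc.trans hcC⟩

set_option maxHeartbeats 400000 in
/-- ★★★ **LEVEL DATA OF THE (b)-ROW KNIT.**  For the `if`-lettered closed forms `hhL` (stair sizes, w3 g11) and `ωL` (oscillation, px9 g6, chart bound `cm`): the four global
sign∕size rows of ✓`hG_of_rows[_σ]` and a level sequence `E` with its four rows at `θG := 3·(23040·h⋆·w⋆ + 4800·w⋆²)`, from the four scalar windows `64h⋆ ≤ 1`, `600w⋆ ≤ 1`,
`160(3b) + 9900w⋆ + 16128h⋆ ≤ 1`, `3b ≤ 1∕200` — k-UNIFORM. [cite: Balaban1985Averaging, Prop. 4 (134)-(135) pp.38-39, (139)-(144) pp.39-40; Balaban1985RegularSpaces, (1.29) p.81] -/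
theorem levelData {ε₀ cm : ℝ} (hε₀ : 0 ≤ ε₀) (hcm : 0 ≤ cm)
    (hhs64 : 64 * (4 * ((((F.P K).d + 2) * (F.P K).L : ℕ) : ℝ) * ((((F.P K).d * ((F.P K).L - 1) : ℕ) : ℝ) * (4 * ε₀) +
      102 / 100 * (240 * (C2 (F.P K).d + 40000 * (((F.P K).d : ℝ) + 2) ^ 2) *
        (((2 * ((F.P K).d * (F.P K).L) + 1) * ((F.P K).d * ((F.P K).L - 1) + (F.P K).L) : ℕ) : ℝ) ^ 2 * ε₀ ^ 2))) ≤ 1)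
    (hws600 : 600 * ((((F.P K).d : ℝ) * (((F.P K).L : ℝ) - 1)) * (256 * (((F.P K).d : ℝ) + 1) * (((F.P K).d : ℝ) + 4) * (2 * ε₀) + cm) + 2 * (64 * ((F.P K).d : ℝ) * cm) +
      (64 * ((F.P K).d : ℝ) * cm) ^ 2 + (2 * (64 * ((F.P K).d : ℝ) * cm) + (64 * ((F.P K).d : ℝ) * cm) ^ 2) *
        ((((F.P K).d : ℝ) * (((F.P K).L : ℝ) - 1)) * (256 * (((F.P K).d : ℝ) + 1) * (((F.P K).d : ℝ) + 4) * (2 * ε₀) + cm))) ≤ 1)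
    (hwin : 160 * (3 * (23040 *
        (4 * ((((F.P K).d + 2) * (F.P K).L : ℕ) : ℝ) * ((((F.P K).d * ((F.P K).L - 1) : ℕ) : ℝ) * (4 * ε₀) +
          102 / 100 * (240 * (C2 (F.P K).d + 40000 * (((F.P K).d : ℝ) + 2) ^ 2) *
            (((2 * ((F.P K).d * (F.P K).L) + 1) * ((F.P K).d * ((F.P K).L - 1) + (F.P K).L) : ℕ) : ℝ) ^ 2 * ε₀ ^ 2))) *
        ((((F.P K).d : ℝ) * (((F.P K).L : ℝ) - 1)) * (256 * (((F.P K).d : ℝ) + 1) * (((F.P K).d : ℝ) + 4) * (2 * ε₀) + cm) + 2 * (64 * ((F.P K).d : ℝ) * cm) +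
          (64 * ((F.P K).d : ℝ) * cm) ^ 2 + (2 * (64 * ((F.P K).d : ℝ) * cm) + (64 * ((F.P K).d : ℝ) * cm) ^ 2) *
            ((((F.P K).d : ℝ) * (((F.P K).L : ℝ) - 1)) * (256 * (((F.P K).d : ℝ) + 1) * (((F.P K).d : ℝ) + 4) * (2 * ε₀) + cm))) +
        4800 * ((((F.P K).d : ℝ) * (((F.P K).L : ℝ) - 1)) * (256 * (((F.P K).d : ℝ) + 1) * (((F.P K).d : ℝ) + 4) * (2 * ε₀) + cm) + 2 * (64 * ((F.P K).d : ℝ) * cm) +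
          (64 * ((F.P K).d : ℝ) * cm) ^ 2 + (2 * (64 * ((F.P K).d : ℝ) * cm) + (64 * ((F.P K).d : ℝ) * cm) ^ 2) *
            ((((F.P K).d : ℝ) * (((F.P K).L : ℝ) - 1)) * (256 * (((F.P K).d : ℝ) + 1) * (((F.P K).d : ℝ) + 4) * (2 * ε₀) + cm))) ^ 2)) +
      9900 * ((((F.P K).d : ℝ) * (((F.P K).L : ℝ) - 1)) * (256 * (((F.P K).d : ℝ) + 1) * (((F.P K).d : ℝ) + 4) * (2 * ε₀) + cm) + 2 * (64 * ((F.P K).d : ℝ) * cm) +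
          (64 * ((F.P K).d : ℝ) * cm) ^ 2 + (2 * (64 * ((F.P K).d : ℝ) * cm) + (64 * ((F.P K).d : ℝ) * cm) ^ 2) *
            ((((F.P K).d : ℝ) * (((F.P K).L : ℝ) - 1)) * (256 * (((F.P K).d : ℝ) + 1) * (((F.P K).d : ℝ) + 4) * (2 * ε₀) + cm))) +
      16128 * (4 * ((((F.P K).d + 2) * (F.P K).L : ℕ) : ℝ) * ((((F.P K).d * ((F.P K).L - 1) : ℕ) : ℝ) * (4 * ε₀) +
          102 / 100 * (240 * (C2 (F.P K).d + 40000 * (((F.P K).d : ℝ) + 2) ^ 2) *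
            (((2 * ((F.P K).d * (F.P K).L) + 1) * ((F.P K).d * ((F.P K).L - 1) + (F.P K).L) : ℕ) : ℝ) ^ 2 * ε₀ ^ 2))) ≤ 1)
    (hsmall : 3 * (23040 *
        (4 * ((((F.P K).d + 2) * (F.P K).L : ℕ) : ℝ) * ((((F.P K).d * ((F.P K).L - 1) : ℕ) : ℝ) * (4 * ε₀) +
          102 / 100 * (240 * (C2 (F.P K).d + 40000 * (((F.P K).d : ℝ) + 2) ^ 2) *
            (((2 * ((F.P K).d * (F.P K).L) + 1) * ((F.P K).d * ((F.P K).L - 1) + (F.P K).L) : ℕ) : ℝ) ^ 2 * ε₀ ^ 2))) *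
        ((((F.P K).d : ℝ) * (((F.P K).L : ℝ) - 1)) * (256 * (((F.P K).d : ℝ) + 1) * (((F.P K).d : ℝ) + 4) * (2 * ε₀) + cm) + 2 * (64 * ((F.P K).d : ℝ) * cm) +
          (64 * ((F.P K).d : ℝ) * cm) ^ 2 + (2 * (64 * ((F.P K).d : ℝ) * cm) + (64 * ((F.P K).d : ℝ) * cm) ^ 2) *
            ((((F.P K).d : ℝ) * (((F.P K).L : ℝ) - 1)) * (256 * (((F.P K).d : ℝ) + 1) * (((F.P K).d : ℝ) + 4) * (2 * ε₀) + cm))) +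
        4800 * ((((F.P K).d : ℝ) * (((F.P K).L : ℝ) - 1)) * (256 * (((F.P K).d : ℝ) + 1) * (((F.P K).d : ℝ) + 4) * (2 * ε₀) + cm) + 2 * (64 * ((F.P K).d : ℝ) * cm) +
          (64 * ((F.P K).d : ℝ) * cm) ^ 2 + (2 * (64 * ((F.P K).d : ℝ) * cm) + (64 * ((F.P K).d : ℝ) * cm) ^ 2) *
            ((((F.P K).d : ℝ) * (((F.P K).L : ℝ) - 1)) * (256 * (((F.P K).d : ℝ) + 1) * (((F.P K).d : ℝ) + 4) * (2 * ε₀) + cm))) ^ 2) ≤ 1 / 200) :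
    let hhL : ℕ → ℝ := fun j => if j < K - n then
        4 * ((((F.P K).d + 2) * (F.P K).L : ℕ) : ℝ) *
          ((((F.P K).d * ((F.P K).L - 1) : ℕ) : ℝ) * (4 * ε₀ * (((F.P K).L : ℝ) ^ j) ^ 2 * ((((F.P K).L : ℝ) ^ (K - n))⁻¹) ^ 2) +
            102 / 100 * (240 * (C2 (F.P K).d + 40000 * (((F.P K).d : ℝ) + 2) ^ 2) *
              (((2 * ((F.P K).d * (F.P K).L) + 1) * ((F.P K).d * ((F.P K).L - 1) + (F.P K).L) : ℕ) : ℝ) ^ 2 * ε₀ ^ 2 *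
              ((((F.P K).L : ℝ) ^ j) ^ 4 * ((((F.P K).L : ℝ) ^ (K - n))⁻¹) ^ 4))) else 0
    let ωL : ℕ → ℝ := fun j => if j < K - n then
        (((F.P K).d : ℝ) * (((F.P K).L : ℝ) - 1)) * (256 * (((F.P K).d : ℝ) + 1) * (((F.P K).d : ℝ) + 4) * (2 * ε₀) * (((F.P K).L : ℝ) ^ j * (((F.P K).L : ℝ) ^ (K - n))⁻¹) ^ 2 +
            ((F.P K).L : ℝ) ^ j * (((F.L : ℝ)⁻¹) ^ (K - n) * cm))
          + 2 * (64 * ((F.P K).d : ℝ) * (((F.P K).L : ℝ) ^ j * (((F.L : ℝ)⁻¹) ^ (K - n) * cm)))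
          + (64 * ((F.P K).d : ℝ) * (((F.P K).L : ℝ) ^ j * (((F.L : ℝ)⁻¹) ^ (K - n) * cm))) ^ 2
          + (2 * (64 * ((F.P K).d : ℝ) * (((F.P K).L : ℝ) ^ j * (((F.L : ℝ)⁻¹) ^ (K - n) * cm))) +
              (64 * ((F.P K).d : ℝ) * (((F.P K).L : ℝ) ^ j * (((F.L : ℝ)⁻¹) ^ (K - n) * cm))) ^ 2) *
            ((((F.P K).d : ℝ) * (((F.P K).L : ℝ) - 1)) * (256 * (((F.P K).d : ℝ) + 1) * (((F.P K).d : ℝ) + 4) * (2 * ε₀) * (((F.P K).L : ℝ) ^ j * (((F.P K).L : ℝ) ^ (K - n))⁻¹) ^ 2 +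
              ((F.P K).L : ℝ) ^ j * (((F.L : ℝ)⁻¹) ^ (K - n) * cm))) else 0
    (∀ j, 0 ≤ hhL j) ∧ (∀ j, hhL j ≤ 1 / 64) ∧ (∀ j, 0 ≤ ωL j) ∧ (∀ j, ωL j ≤ 1 / 600) ∧
      ∃ E : ℕ → ℝ, 0 ≤ E 0 ∧ (∀ j, j ≤ K - n → E j ≤ 1 / 200) ∧
        (∀ j, j < K - n →
          E j + 160 * E j ^ 2 + 3300 * E j * (3 * ωL j) + 5 * (1536 * hhL j * (3 * ωL j + 21 / 10 * E j)) + 4 * (1200 * ωL j ^ 2) ≤ E (j + 1)) ∧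
        E (K - n) ≤ 3 * (23040 *
        (4 * ((((F.P K).d + 2) * (F.P K).L : ℕ) : ℝ) * ((((F.P K).d * ((F.P K).L - 1) : ℕ) : ℝ) * (4 * ε₀) +
          102 / 100 * (240 * (C2 (F.P K).d + 40000 * (((F.P K).d : ℝ) + 2) ^ 2) *
            (((2 * ((F.P K).d * (F.P K).L) + 1) * ((F.P K).d * ((F.P K).L - 1) + (F.P K).L) : ℕ) : ℝ) ^ 2 * ε₀ ^ 2))) *
        ((((F.P K).d : ℝ) * (((F.P K).L : ℝ) - 1)) * (256 * (((F.P K).d : ℝ) + 1) * (((F.P K).d : ℝ) + 4) * (2 * ε₀) + cm) + 2 * (64 * ((F.P K).d : ℝ) * cm) +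
          (64 * ((F.P K).d : ℝ) * cm) ^ 2 + (2 * (64 * ((F.P K).d : ℝ) * cm) + (64 * ((F.P K).d : ℝ) * cm) ^ 2) *
            ((((F.P K).d : ℝ) * (((F.P K).L : ℝ) - 1)) * (256 * (((F.P K).d : ℝ) + 1) * (((F.P K).d : ℝ) + 4) * (2 * ε₀) + cm))) +
        4800 * ((((F.P K).d : ℝ) * (((F.P K).L : ℝ) - 1)) * (256 * (((F.P K).d : ℝ) + 1) * (((F.P K).d : ℝ) + 4) * (2 * ε₀) + cm) + 2 * (64 * ((F.P K).d : ℝ) * cm) +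
          (64 * ((F.P K).d : ℝ) * cm) ^ 2 + (2 * (64 * ((F.P K).d : ℝ) * cm) + (64 * ((F.P K).d : ℝ) * cm) ^ 2) *
            ((((F.P K).d : ℝ) * (((F.P K).L : ℝ) - 1)) * (256 * (((F.P K).d : ℝ) + 1) * (((F.P K).d : ℝ) + 4) * (2 * ε₀) + cm))) ^ 2) := by
  intro hhL ωL
  -- letters
  set k : ℕ := K - n with hk
  set Lr : ℝ := ((F.P K).L : ℝ) with hLr
  set ℓ : ℝ := ((((F.P K).d + 2) * (F.P K).L : ℕ) : ℝ) with hℓ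
  set dd : ℝ := ((((F.P K).d * ((F.P K).L - 1) : ℕ) : ℝ)) with hdd
  set R : ℝ := 240 * (C2 (F.P K).d + 40000 * (((F.P K).d : ℝ) + 2) ^ 2) *
    (((2 * ((F.P K).d * (F.P K).L) + 1) * ((F.P K).d * ((F.P K).L - 1) + (F.P K).L) : ℕ) : ℝ) ^ 2 * ε₀ ^ 2 with hR
  set D : ℝ := ((F.P K).d : ℝ) * (Lr - 1) with hD
  set C : ℝ := 256 * (((F.P K).d : ℝ) + 1) * (((F.P K).d : ℝ) + 4) with hC
  set G : ℝ := 64 * ((F.P K).d : ℝ) with hG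
  set hs : ℝ := 4 * ℓ * (dd * (4 * ε₀) + 102 / 100 * R) with hhs
  set ws : ℝ := D * (C * (2 * ε₀) + cm) + 2 * (G * cm) + (G * cm) ^ 2 + (2 * (G * cm) + (G * cm) ^ 2) * (D * (C * (2 * ε₀) + cm)) with hws
  have hFL : (F.L : ℝ) = Lr := by rw [hLr]; rfl
  have hL3 : 3 ≤ (F.P K).L := by have hodd : Odd (F.P K).L := F.hL.1; have h2 := (F.P K).hL.2; obtain ⟨t, ht⟩ := hodd; omega
  have hLr3 : (3 : ℝ) ≤ Lr := by rw [hLr]; exact_mod_cast hL3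
  have hLr1 : (1 : ℝ) ≤ Lr := by linarith
  have hLr0 : (0 : ℝ) < Lr := by linarith
  have hR0 : 0 ≤ R := by rw [hR]; have := C1_pos (F.P K).d; unfold C2; positivity
  have hℓ0 : 0 ≤ ℓ := Nat.cast_nonneg _
  have hdd0 : 0 ≤ dd := Nat.cast_nonneg _
  have hD0 : 0 ≤ D := by rw [hD]; exact mul_nonneg (Nat.cast_nonneg _) (by linarith)
  have hC0 : 0 ≤ C := by rw [hC]; positivity
  have hG0 : 0 ≤ G := by rw [hG]; positivity
  have hhs0 : 0 ≤ hs := by rw [hhs]; positivity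
  have hws0 : 0 ≤ ws := by rw [hws]; positivity
  -- the level ratio letters
  have hratio : ∀ j, j ≤ k → 0 ≤ Lr ^ j * (Lr ^ k)⁻¹ ∧ Lr ^ j * (Lr ^ k)⁻¹ ≤ 1 := fun j hj => ⟨levelRatio_nonneg hLr0.le j k, levelRatio_le_one hLr1 hj⟩
  have hη : ∀ j, Lr ^ j * (((F.L : ℝ)⁻¹) ^ (K - n) * cm) = cm * (Lr ^ j * (Lr ^ k)⁻¹) := fun j => by rw [hFL]; exact pow_mul_inv_pow_mul_eq j k
  -- the two closed forms under their majorants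
  have hhh : ∀ j, j < k → hhL j ≤ hs * (Lr ^ j * (Lr ^ k)⁻¹) := fun j hj => by
    show (if j < K - n then _ else _) ≤ _
    rw [if_pos hj, hhs]
    exact stairSize_closedForm_le_mul_levelRatio hLr1 hℓ0 hdd0 hε₀ hR0 hj.le
  have hhL0 : ∀ j, j < k → 0 ≤ hhL j := fun j hj => by
    show 0 ≤ (if j < K - n then _ else _)
    rw [if_pos hj]; positivity
  have hωω : ∀ j, j < k → ωL j ≤ ws * (Lr ^ j * (Lr ^ k)⁻¹) := fun j hj => by
    show (if j < K - n then _ else _) ≤ _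
    rw [if_pos hj, hη j, hws]
    have hs' : cm * (Lr ^ j * (Lr ^ k)⁻¹) ≤ cm * (Lr ^ j * (Lr ^ k)⁻¹) := le_rfl
    exact omega_closedForm_le_mul_levelRatio hD0 hC0 hε₀ hG0 hcm (hratio j hj.le).1 (hratio j hj.le).2 (by have := (hratio j hj.le).1; positivity) hs'
  have hωL0 : ∀ j, j < k → 0 ≤ ωL j := fun j hj => by
    show 0 ≤ (if j < K - n then _ else _)
    rw [if_pos hj, hη j]
    have := (hratio j hj.le).1
    positivity
  -- the four global rows
  have hhs64' : hs ≤ 1 / 64 := by rw [hhs]; linarith [hhs64]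
  have hws600' : ws ≤ 1 / 600 := by rw [hws]; linarith [hws600]
  have hrow_h := fun j => if_level_bounds (k := k) hLr1 hhs0 hhs64' (fun j => hhL j) hhL0 hhh j
  have hrow_ω := fun j => if_level_bounds (k := k) hLr1 hws0 hws600' (fun j => ωL j) hωL0 hωω j
  have e_h : ∀ j, (if j < k then hhL j else 0) = hhL j := fun j => by
    by_cases hj : j < k
    · rw [if_pos hj]
    · rw [if_neg hj]; show (0 : ℝ) = (if j < K - n then _ else _); rw [if_neg hj]
  have e_ω : ∀ j, (if j < k then ωL j else 0) = ωL j := fun j => by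
    by_cases hj : j < k
    · rw [if_pos hj]
    · rw [if_neg hj]; show (0 : ℝ) = (if j < K - n then _ else _); rw [if_neg hj]
  refine ⟨fun j => by rw [← e_h j]; exact (hrow_h j).1, fun j => by rw [← e_h j]; exact (hrow_h j).2,
    fun j => by rw [← e_ω j]; exact (hrow_ω j).1, fun j => by rw [← e_ω j]; exact (hrow_ω j).2, ?_⟩
  -- the level sequence
  have hwin' : 160 * (3 * (23040 * hs * ws + 4800 * ws ^ 2)) + 9900 * ws + 16128 * hs ≤ 1 := by rw [hhs, hws]; exact hwin
  have hsmall' : 3 * (23040 * hs * ws + 4800 * ws ^ 2) ≤ 1 / 200 := by rw [hhs, hws]; exact hsmall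
  obtain ⟨E, hE0, hE1, hE, hEk⟩ := exists_levelSeq_rows_L k hLr3 hhs0 hws0 hhL ωL hhL0 hωL0 hhh hωω hwin' hsmall' le_rfl
  refine ⟨E, hE0, hE1, hE, ?_⟩
  rw [hhs, hws] at hEk
  exact hEk

end Summit.QuantumFields.YangMills.Theorems.HalvingHStokesRowLevelData

end
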